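import Literature.NumberTheory.EllipticCurves.CMFormalActionNilIdealPoints
import HarnessLib

/-!
# The CM transformation identity at points of the formal group, `y`-coordinate: descent and evaluation of
# `α·ỹ₁([α] t)·Q(x₀(t) + b) + (x₁([α] t) + b)·Q′·ỹ₀(t) = P′·ỹ₀(t)` (de Shalit II.1.10 / II.4.9 — proofs only)

Topic `NumberTheory/EllipticCurves` (theorems only; no definition, no named fact, no instance).  Companion of `CMFormalActionNilIdealPoints`
(the `x`-coordinate) for the `y`-shape identity produced over `ℂ` by `CMFormalActionTaylorYProofs.translateY_cm_identity`:
with series `X₀, Y₀, X₁, Y₁ ∈ R⟦t⟧` (the translate expansions at `ξ(Ω)`, `ξ(αΩ)`), a constant-term-free `T` (`[α]_Ê`), polynomials `P, Q`,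
a scalar `α` and the shift `b`, writing `ỹ₀ := 2Y₀ + a₁X₀ + a₃`:
`α·(2·Y₁∘T + a₁·X₁∘T + a₃)·Q(X₀ + b) + (X₁∘T + b)·Q′(X₀ + b)·ỹ₀ = P′(X₀ + b)·ỹ₀`.

* `cmY_identity_of_map_eq` — DESCENT along an injective `φ : R →+* S`;
* ★ `evalAt_cmY_identity` — EVALUATION at `t ∈ 𝔪_K`: the same identity among the values `X₀(t), Y₀(t), X₁(T t), Y₁(T t) ∈ 𝒪_K`
  (by `FormalGroupNilIdealPointsTranslate.some_add_ptOfZ` these are the coordinates of `P₁ ⊕ P(t)` and `P₁^α ⊕ P(T t)`): with the `x`-identity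
  of `CMFormalActionNilIdealPoints` this pins `P₁^α ⊕ P(T t)` as the image of `P₁ ⊕ P(t)` under the chart `(R, R′·ỹ/(αQ²)…)` of `[α]` —
  (CM-POINTS)(ii) of the cell's CM bridge, both coordinates.

Cell `bsd-print-cf2`, width seat `bsd-line-cf2c-w4` g14; no summit statement is proved; BSD is not proved by any of this.

## References
* [deShalit1987] E. de Shalit, *Iwasawa theory of elliptic curves with complex multiplication* (1987), II §1.10, §4.9 (ii).
* [SilvermanATAEC1994] J. H. Silverman, *Advanced Topics in the Arithmetic of Elliptic Curves* (1994), II Prop. 1.1, §II.2.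
-/

noncomputable section

open scoped Classical
open PowerSeries

namespace Literature.NumberTheory.EllipticCurves

open Literature.NumberTheory.GaloisRepresentations.LubinTate

/-! ## §0 Descent -/

section Descent

variable {R S : Type*} [CommRing R] [CommRing S] (φ : R →+* S)

/-- **Descent of the `y`-shape CM identity along an injective `φ : R →+* S`.** [cite: SilvermanATAEC1994, II §2] -/
theorem cmY_identity_of_map_eq (hφ : Function.Injective φ) {X₀ Y₀ X₁ Y₁ T : PowerSeries R} (hT : constantCoeff T = 0)
    {α b a₁ a₃ : R} {P Q : Polynomial R}
    (h : C (φ α) * (2 * PowerSeries.subst (T.map φ) (Y₁.map φ) + C (φ a₁) * PowerSeries.subst (T.map φ) (X₁.map φ) + C (φ a₃)) *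
          Polynomial.aeval (X₀.map φ + C (φ b)) (Q.map φ) +
        (PowerSeries.subst (T.map φ) (X₁.map φ) + C (φ b)) * Polynomial.aeval (X₀.map φ + C (φ b)) (Polynomial.derivative (Q.map φ)) *
          (2 * Y₀.map φ + C (φ a₁) * X₀.map φ + C (φ a₃)) =
      Polynomial.aeval (X₀.map φ + C (φ b)) (Polynomial.derivative (P.map φ)) * (2 * Y₀.map φ + C (φ a₁) * X₀.map φ + C (φ a₃))) :
    C α * (2 * PowerSeries.subst T Y₁ + C a₁ * PowerSeries.subst T X₁ + C a₃) * Polynomial.aeval (X₀ + C b) Q +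
        (PowerSeries.subst T X₁ + C b) * Polynomial.aeval (X₀ + C b) (Polynomial.derivative Q) * (2 * Y₀ + C a₁ * X₀ + C a₃) =
      Polynomial.aeval (X₀ + C b) (Polynomial.derivative P) * (2 * Y₀ + C a₁ * X₀ + C a₃) := by
  apply PowerSeries.map_injective φ hφ
  have hcomm := algebraMap_comp_eq_map_comp_algebraMap φ
  have hs : ∀ F : PowerSeries R, PowerSeries.map φ (PowerSeries.subst T F) = PowerSeries.subst (T.map φ) (F.map φ) := fun F =>
    PowerSeries.map_subst (PowerSeries.HasSubst.of_constantCoeff_zero' hT) (h := φ) F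
  rw [map_add, map_mul, map_mul, map_mul, map_mul, map_mul, map_add, map_add, map_mul, map_mul, hs, hs, PowerSeries.map_C,
    PowerSeries.map_C, PowerSeries.map_C, map_ofNat, Polynomial.map_aeval_eq_aeval_map hcomm, Polynomial.map_aeval_eq_aeval_map hcomm,
    Polynomial.map_aeval_eq_aeval_map hcomm, map_add, PowerSeries.map_C, map_add, PowerSeries.map_C, map_add, map_add, map_mul,
    map_mul, map_ofNat, PowerSeries.map_C, PowerSeries.map_C, hs]
  rw [Polynomial.derivative_map, Polynomial.derivative_map] at h
  exact h

end Descent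

/-! ## §1 Evaluation at points of `𝔪_K` -/

variable {A : Type*} [CommRing A] [UniformSpace A] [DiscreteUniformity A]
  {K : Type*} [NontriviallyNormedField K] [IsUltrametricDist K] [CompleteSpace K]
  [Algebra A (unitBall K)] [ContinuousSMul A (unitBall K)]

/-- ★ **The `y`-shape CM identity at points of the formal group**: at every `t ∈ 𝔪_K`,
`α·(2Y₁(T t) + a₁X₁(T t) + a₃)·Q(X₀(t) + b) + (X₁(T t) + b)·Q′(X₀(t) + b)·ỹ₀(t) = P′(X₀(t) + b)·ỹ₀(t)` in `𝒪_K`, `ỹ₀(t) = 2Y₀(t) + a₁X₀(t) + a₃`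
(`evalAt` is an `A`-algebra map; `evalAt_subst₁`). [cite: deShalit1987, II §1.10, §4.9 (ii)] [cite: SilvermanATAEC1994, II Prop. 1.1] -/
theorem evalAt_cmY_identity {X₀ Y₀ X₁ Y₁ T : PowerSeries A} (hT : constantCoeff T = 0) {α b a₁ a₃ : A} {P Q : Polynomial A}
    (hid : C α * (2 * PowerSeries.subst T Y₁ + C a₁ * PowerSeries.subst T X₁ + C a₃) * Polynomial.aeval (X₀ + C b) Q +
        (PowerSeries.subst T X₁ + C b) * Polynomial.aeval (X₀ + C b) (Polynomial.derivative Q) * (2 * Y₀ + C a₁ * X₀ + C a₃) =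
      Polynomial.aeval (X₀ + C b) (Polynomial.derivative P) * (2 * Y₀ + C a₁ * X₀ + C a₃))
    (t : (ballNilIdeal K).toIdeal) :
    algebraMap A (unitBall K) α *
          (2 * evalAt (ballNilIdeal K) (evalPt₁ (ballNilIdeal K) T hT t) Y₁ +
            algebraMap A (unitBall K) a₁ * evalAt (ballNilIdeal K) (evalPt₁ (ballNilIdeal K) T hT t) X₁ + algebraMap A (unitBall K) a₃) *
        Polynomial.aeval (evalAt (ballNilIdeal K) t X₀ + algebraMap A (unitBall K) b) Q +
      (evalAt (ballNilIdeal K) (evalPt₁ (ballNilIdeal K) T hT t) X₁ + algebraMap A (unitBall K) b) *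
        Polynomial.aeval (evalAt (ballNilIdeal K) t X₀ + algebraMap A (unitBall K) b) (Polynomial.derivative Q) *
        (2 * evalAt (ballNilIdeal K) t Y₀ + algebraMap A (unitBall K) a₁ * evalAt (ballNilIdeal K) t X₀ + algebraMap A (unitBall K) a₃) =
      Polynomial.aeval (evalAt (ballNilIdeal K) t X₀ + algebraMap A (unitBall K) b) (Polynomial.derivative P) *
        (2 * evalAt (ballNilIdeal K) t Y₀ + algebraMap A (unitBall K) a₁ * evalAt (ballNilIdeal K) t X₀ + algebraMap A (unitBall K) a₃) := by
  have h := congrArg (evalAt (ballNilIdeal K) t) hid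
  simp only [map_add, map_mul, map_ofNat, evalAt_C', evalAt_subst₁ t T hT, evalAt_aeval] at h
  exact h

end Literature.NumberTheory.EllipticCurves

end
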